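import Mathlib
import Summits.Ventures.HodgeRepro.Tier4.Common.AdelicDefs
import Summits.Ventures.HodgeRepro.Tier4.Common.RowPlane
import Summits.Ventures.HodgeRepro.Tier4.Common.MixedPlaneKType

/-!
# Tier4/Line4/ProjPlane — C-L4-PROJ, plane half: on the seesaw plane `(mixedRow q a₀ a₂).withTransportedTorus g g′`
the transported local torus conjugates, by `κ ↦ g′ κ g`, INTO the torus of the ROW plane `mixedRow q a₁ a₃`

Blind re-derivation cell `pub-hodge-repro`, Tier 4 «prove the step» (README §9–§10), LINE L4; statements typed by
t4-plan-4 g2 (S13967, proofs/t4-plan-4/Tier4/Line4/CUT-C-L4-PROJ-plane.lean ed6772bf5bba8b68 · 44, VERBATIM), proved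
by t4-typer-2 g3 on the planner's word.  Target tree path `lean/Summits/Ventures/HodgeRepro/Tier4/Line4/ProjPlane.lean`.
Mathlib + Common.{AdelicDefs, RowPlane, MixedPlaneKType}; no literature.

WHY.  `TestProjectorVanishing.weightAt'_mul_of_conj` / `norm_weightAt'_eq_one_of_conj` make the transported weights
`weightAt' W' q w g g' j` unit characters of `localTorusAt' W' w'` PROVIDED `hconj : ∀ κ ∈ localTorusAt' W' w', ∃ κ' ∈
torusT (ofLinesRow q a b ε), GA.mat _ κ' = adMat k g' * GA.mat W' κ * adMat k g`.  Here `hconj` is PROVED for the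
seesaw plane under the wall's similitude display (`hgg' hg'g hgΩ lam hlam hiso`, Skeleton v0.24 L556–L583):
* `κ` commutes with `Q_i = g P_i g′` (`withTransportedTorus_Q`) ⇒ `g′ κ g` commutes with `P_i` (every `ofLinesRow`
  has the same `P`);
* `κ Ω = Ω κ` and `g Ω = Ω g` ⇒ `(g′ κ g) Ω = Ω (g′ κ g)` (every `ofLinesRow` has the same `Ω`);
* `κ B κᵀ = B` and `B′ = λ · g′ B g′ᵀ` (from `hiso` by conjugating with `g′`) ⇒ `(g′ κ g) B′ (g′ κ g)ᵀ = B′`;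
so `g′ κ g` is a unitary element of `mixedRow q a₁ a₃ = ofLinesRow q a₁ a₃ (−1)` lying in its torus.  `hlam` is not
used (the binder is kept so the statement is byte-parallel to the wall's display).

* `adMat_mul_adMat_eq_one` — the adelic inverse pair from the rational one;
* **`localTorusAt'_withTransportedTorus_conj`** — the `hconj` of the seesaw plane.

Nothing here says anything about the status of the Hodge conjecture for CM abelian varieties, which is NOT proved
(HC_CM is NOT proved by anyone in this repository).
-/

set_option autoImplicit false

noncomputable section

namespace Summit.Ventures.HodgeRepro.Tier4.Line4

open Summit.Ventures.HodgeRepro.Tier4.Common Matrix NumberField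

variable {k : Type} [Field k] [NumberField k]

/-- the adelic inverse pair from the rational one (the `hgg'` shape of `weightAt'_mul_of_conj`). -/
theorem adMat_mul_adMat_eq_one (g g' : Matrix (Fin 4) (Fin 4) k) (hgg' : g * g' = 1) :
    adMat k g * adMat k g' = 1 := by
  rw [← adMat_mul, hgg', adMat_one]

/-- The transpose of a principal adelic matrix is the principal matrix of the transpose. -/
theorem adMat_transpose (g : Matrix (Fin 4) (Fin 4) k) : (adMat k g)ᵀ = adMat k gᵀ :=
  (Matrix.transpose_map (f := algebraMap k (Ad k)) (M := g)).symm

/-- A principal adelic matrix of a scalar multiple. -/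
theorem adMat_smul (c : k) (B : Matrix (Fin 4) (Fin 4) k) : adMat k (c • B) = algebraMap k (Ad k) c • adMat k B := by
  ext i j
  simp only [adMat, Matrix.map_apply, Matrix.smul_apply, smul_eq_mul, map_mul]

/-- **C-L4-PROJ, plane half — `hconj` for the seesaw plane**: `g′ T′ g` is the torus of the row plane
`mixedRow q a₁ a₃` under the wall's similitude display. -/
theorem localTorusAt'_withTransportedTorus_conj (q : QuadData k) (a : Fin 4 → k)
    (g g' : Matrix (Fin 4) (Fin 4) k) (hgg' : g * g' = 1) (hg'g : g' * g = 1)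
    (hgΩ : g * (PlaneData.mixedRow q (a 0) (a 2)).Ω = (PlaneData.mixedRow q (a 0) (a 2)).Ω * g)
    (lam : k) (_hlam : lam ≠ 0)
    (hiso : g * (PlaneData.mixedRow q (a 1) (a 3)).B * gᵀ = lam • (PlaneData.mixedRow q (a 0) (a 2)).B)
    (w : InfinitePlace k) :
    ∀ κ ∈ localTorusAt' ((PlaneData.mixedRow q (a 0) (a 2)).withTransportedTorus g g' hgg' hg'g hgΩ) w,
      ∃ κ' ∈ torusT (PlaneData.ofLinesRow q (a 1) (a 3) (-1)),
        GA.mat (PlaneData.ofLinesRow q (a 1) (a 3) (-1)) κ' =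
          adMat k g' * GA.mat ((PlaneData.mixedRow q (a 0) (a 2)).withTransportedTorus g g' hgg' hg'g hgΩ) κ *
            adMat k g := by
  intro κ hκ
  obtain ⟨hκT', -⟩ := hκ
  -- the adelic inverse pair
  have hA : adMat k g * adMat k g' = 1 := adMat_mul_adMat_eq_one g g' hgg'
  have hA' : adMat k g' * adMat k g = 1 := adMat_mul_adMat_eq_one g' g hg'g
  -- notation for the matrices of the two planes (the same `Ω` and `P`, the forms `B₀`, `B₁`)
  set M : M4 k := GA.mat ((PlaneData.mixedRow q (a 0) (a 2)).withTransportedTorus g g' hgg' hg'g hgΩ) κ with hM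
  set Ω : Matrix (Fin 4) (Fin 4) k := (PlaneData.mixedRow q (a 0) (a 2)).Ω with hΩdef
  set B₀ : Matrix (Fin 4) (Fin 4) k := (PlaneData.mixedRow q (a 0) (a 2)).B with hB₀def
  set B₁ : Matrix (Fin 4) (Fin 4) k := (PlaneData.mixedRow q (a 1) (a 3)).B with hB₁def
  set P : Fin 2 → Matrix (Fin 4) (Fin 4) k := (PlaneData.mixedRow q (a 0) (a 2)).P with hPdef
  -- the unitary relations of `κ`
  have hΩ : M * adMat k Ω = adMat k Ω * M := κ.2.1
  have hB : M * adMat k B₀ * Mᵀ = adMat k B₀ := κ.2.2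
  -- `κ` commutes with the transported projectors `Q i = g P i g'`
  have hQ : ∀ i, M * adMat k (g * P i * g') = adMat k (g * P i * g') * M := by
    intro i
    fin_cases i
    · exact hκT'.1
    · exact hκT'.2
  -- the conjugate matrix
  set M' : M4 k := adMat k g' * M * adMat k g with hM'
  -- (a) `M'` commutes with `P i`
  have hP' : ∀ i, M' * adMat k (P i) = adMat k (P i) * M' := by
    intro i
    have h := hQ i
    rw [adMat_mul, adMat_mul] at h
    have e1 : M' * adMat k (P i) = adMat k g' * ((M * (adMat k g * adMat k (P i) * adMat k g')) * adMat k g) := by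
      rw [hM']
      simp only [Matrix.mul_assoc]
      rw [hA', Matrix.mul_one]
    rw [e1, h, hM']
    simp only [Matrix.mul_assoc]
    rw [← Matrix.mul_assoc (adMat k g') (adMat k g), hA', Matrix.one_mul]
  -- (b) `M'` commutes with `Ω`
  have h1 : adMat k g * adMat k Ω = adMat k Ω * adMat k g := by
    rw [← adMat_mul, ← adMat_mul]
    exact congrArg (adMat k) hgΩ
  have hgΩ' : adMat k g' * adMat k Ω = adMat k Ω * adMat k g' := by
    have e : adMat k g' * adMat k Ω = adMat k g' * (adMat k Ω * adMat k g) * adMat k g' := by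
      rw [Matrix.mul_assoc, Matrix.mul_assoc, hA, Matrix.mul_one]
    rw [e, ← h1, ← Matrix.mul_assoc, hA', Matrix.one_mul]
  have hΩ' : M' * adMat k Ω = adMat k Ω * M' := by
    rw [hM']
    calc adMat k g' * M * adMat k g * adMat k Ω = adMat k g' * M * (adMat k g * adMat k Ω) := by
          rw [Matrix.mul_assoc]
      _ = adMat k g' * M * (adMat k Ω * adMat k g) := by rw [h1]
      _ = adMat k g' * (M * adMat k Ω) * adMat k g := by simp only [Matrix.mul_assoc]
      _ = adMat k g' * (adMat k Ω * M) * adMat k g := by rw [hΩ]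
      _ = (adMat k g' * adMat k Ω) * M * adMat k g := by simp only [Matrix.mul_assoc]
      _ = (adMat k Ω * adMat k g') * M * adMat k g := by rw [hgΩ']
      _ = adMat k Ω * (adMat k g' * M * adMat k g) := by simp only [Matrix.mul_assoc]
  -- (c) `B₁ = λ · g' B₀ g'ᵀ` and `M'` preserves `B₁`
  have hB₁ : B₁ = lam • (g' * B₀ * g'ᵀ) := by
    have e : B₁ = g' * (g * B₁ * gᵀ) * g'ᵀ := by
      calc B₁ = (g' * g) * B₁ * (g' * g)ᵀ := by
            rw [hg'g, Matrix.transpose_one, Matrix.one_mul, Matrix.mul_one]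
        _ = g' * (g * B₁ * gᵀ) * g'ᵀ := by
            rw [Matrix.transpose_mul]
            simp only [Matrix.mul_assoc]
    rw [e, hiso, Matrix.mul_smul, Matrix.smul_mul]
  have hB₁A : adMat k B₁ = algebraMap k (Ad k) lam • (adMat k g' * adMat k B₀ * (adMat k g')ᵀ) := by
    rw [hB₁, adMat_smul, adMat_mul, adMat_mul, adMat_transpose]
  have hB' : M' * adMat k B₁ * M'ᵀ = adMat k B₁ := by
    have hT : (adMat k g')ᵀ * (adMat k g)ᵀ = 1 := by
      rw [← Matrix.transpose_mul, hA, Matrix.transpose_one]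
    have key : M' * (adMat k g' * adMat k B₀ * (adMat k g')ᵀ) * M'ᵀ = adMat k g' * adMat k B₀ * (adMat k g')ᵀ := by
      rw [hM']
      calc adMat k g' * M * adMat k g * (adMat k g' * adMat k B₀ * (adMat k g')ᵀ) * (adMat k g' * M * adMat k g)ᵀ
          = adMat k g' * (M * ((adMat k g * adMat k g') *
              (adMat k B₀ * (((adMat k g')ᵀ * (adMat k g)ᵀ) * (Mᵀ * (adMat k g')ᵀ))))) := by
            rw [Matrix.transpose_mul, Matrix.transpose_mul]
            simp only [Matrix.mul_assoc]
        _ = adMat k g' * (M * (adMat k B₀ * (Mᵀ * (adMat k g')ᵀ))) := by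
            rw [hA, Matrix.one_mul, hT, Matrix.one_mul]
        _ = adMat k g' * ((M * adMat k B₀ * Mᵀ) * (adMat k g')ᵀ) := by simp only [Matrix.mul_assoc]
        _ = adMat k g' * adMat k B₀ * (adMat k g')ᵀ := by rw [hB]; simp only [Matrix.mul_assoc]
    rw [hB₁A, Matrix.mul_smul, Matrix.smul_mul, key]
  -- `M'` is a unit: `adMat g'`, `M`, `adMat g` are
  let ug : (M4 k)ˣ := ⟨adMat k g, adMat k g', hA, hA'⟩
  let ug' : (M4 k)ˣ := ⟨adMat k g', adMat k g, hA', hA⟩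
  let u : (M4 k)ˣ := ug' * (κ : GL4 k) * ug
  have hu : (u : M4 k) = M' := by
    rw [hM']
    show ((ug' * (κ : GL4 k) * ug : (M4 k)ˣ) : M4 k) = _
    rw [Units.val_mul, Units.val_mul]
  have humem : u ∈ unitaryGroup (PlaneData.ofLinesRow q (a 1) (a 3) (-1)) := by
    rw [mem_unitaryGroup, hu]
    exact ⟨hΩ', hB'⟩
  refine ⟨⟨u, humem⟩, ⟨hP' 0, hP' 1⟩, ?_⟩
  show (u : M4 k) = M'
  exact hu

end Summit.Ventures.HodgeRepro.Tier4.Line4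

end
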